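import Summits.BirchSwinnertonDyer.BirchSwinnertonDyer.Theorems.ThetaPartnerAtTwoMazurTateCongruenceAtTwoRStubIharaSymbolModTwoNegDisc
import Literature.NumberTheory.EllipticCurves.IharaLemmaModTwoSymbolForm
import HarnessLib

/-!
# The Literature fact `ribet1984_ihara_modTwo_symbolForm` (Ihara's lemma mod `2` on Manin-symbol functions, `S₃`-image case) HOLDS
# — it is the landed stub `stub_iharaSymbolModTwoNegDisc` of crux `MazurTateCongruenceAtTwoTop` (stmt-BirchSwinnertonDyer-25797 = 21416)
# (width seat bsd-wall-tp2-p1-w2 g4; `--supports stmt-BirchSwinnertonDyer-25797`; THEOREMS ONLY)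

WHAT. `Literature/NumberTheory/EllipticCurves/IharaLemmaModTwoSymbolForm.lean` (lead bsd-wall-tp2-p1 g11, p632620) types ONE named
fact, `Literature.NumberTheory.EllipticCurves.ribet1984_ihara_modTwo_symbolForm`: for `W/ℚ` globally minimal, good supersingular at `2`
with `Δ_W < 0`, an odd level `N'` off which `W` has good reduction, an odd prime `ℓ`, and a `1`-periodic, even, `2`-integral
`Γ₀(N')`-Manin-symbol function `Φ : ℚ → ℚ̄₂` Hecke-congruent to `a_q(W)` at the primes `q ∤ 2N'ℓ`: `ℤ[1/ℓ]`-translation invariance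
of `Φ` modulo the maximal ideal forces `Φ ≡ 0` modulo the maximal ideal. Its text is, binder for binder, the registered stub
`stub_iharaSymbolModTwoNegDisc` of skeleton `symbol` v6, which width seat bsd-wall-tp2-p1-w3 g0 PROVED (p631156,
`…RStubIharaSymbolModTwoNegDisc`) from `iharaSymbolModTwo_of_notEisenstein` (reduction mod `𝔪`, the `SL₂(ℤ[1/ℓ])` identity, and
`eq_zero_of_dilationInvariant` = Ihara for symbol functions via cell bsd-f2-manin's `relativeIharaShiftVanishingBar_holds`),
`not_isEisensteinEigensystem_two_of_Δ_neg` (bsd-wall-tp2-p1-w2 g3) and `P2.irr_two_of_goodSS_two`. This file records the discharge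
`ribet1984_ihara_modTwo_symbolForm_holds : ribet1984_ihara_modTwo_symbolForm` — the named fact is a TREE THEOREM, so a consumer that
takes it as a sixth hypothesis next to the PUB⁵ bundle (e.g. `mazurTateCongruenceAtTwoTop_of_fiveFacts_ihara hES hSD hBz hSe hAU hIH`,
`…TopOfIhara`) is discharged to the PUB⁵ form by `hIH := ribet1984_ihara_modTwo_symbolForm_holds` (= w3 g0's `…_of_fiveFacts`).

HONEST FRAMING. Nothing new is proved about modular curves here: the content is w3 g0's theorem, re-exported under the Literature
name so that the fact registry and every consumer see it as proved. The crux `MazurTateCongruenceAtTwoTop` stays CONDITIONAL on the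
five print facts of `PublishedInputsHeckeAtTwo` (item 27435) and on nothing else; BSD is not proved by any of this.

References: K. A. Ribet, *Congruence relations between modular forms*, Proc. ICM 1983 (1984), Thm. 4.1, Cor. 4.2, Thm. 4.3;
J.-P. Serre, Ann. of Math. 92 (1970), Thm. 2; J. Manning, J. Shotton, Math. Ann. 379 (2021), Thm. «Ihara's Lemma».
-/

-- justification: the `Summit.BirchSwinnertonDyer.BirchSwinnertonDyer.…` path repeats a component (route-file convention)
set_option linter.dupNamespace false
set_option autoImplicit false

noncomputable section

open Literature.NumberTheory.EllipticCurves Literature.NumberTheory.EllipticCurves.ModularForms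

namespace Summit.BirchSwinnertonDyer.BirchSwinnertonDyer.Theorems.MazurTateCongruenceAtTwoR

/-- **The named fact `ribet1984_ihara_modTwo_symbolForm` holds**: Ihara's lemma mod `2` read on Manin-symbol functions in the
absolutely irreducible (`Δ_W < 0`, good supersingular at `2`) case is the landed theorem `stub_iharaSymbolModTwoNegDisc`
(bsd-wall-tp2-p1-w3 g0, p631156) — same statement, binder for binder. [cite: Ribet1984ICM, Thm. 4.1, Cor. 4.2 and Thm. 4.3]
[cite: Serre1970SL2, Thm. 2] -/
theorem ribet1984_ihara_modTwo_symbolForm_holds : ribet1984_ihara_modTwo_symbolForm :=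
  fun W _ _ ↦ stub_iharaSymbolModTwoNegDisc W

end Summit.BirchSwinnertonDyer.BirchSwinnertonDyer.Theorems.MazurTateCongruenceAtTwoR

end
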